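import Literature.NumberTheory.EllipticCurves.HasseManinFunctionField
import Literature.NumberTheory.EllipticCurves.HasseManinPolynomials
import Literature.NumberTheory.EllipticCurves.TorsionCardinality
import HarnessLib

/-!
# Hasse's theorem via Manin's argument, III–V: the basic identity, `d₋₁ = #W(F)`, the bound

This module contains parts III, IV and V of the characteristic-free formalisation of Manin's
elementary proof of **Hasse's theorem** `|#W(𝔽_q) - q - 1| ≤ 2√q` (Silverman, *AEC* Thm. V.1.1)
whose overview, notation (`Q = (t, s)`, `P₀ = (t^q, s^q)`, `P_n = P₀ + n • Q`, `d_n`) and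
definitions are in `Literature.NumberTheory.EllipticCurves.HasseManinFunctionField` (part I) and
whose polynomial bookkeeping is in `Literature.NumberTheory.EllipticCurves.HasseManinPolynomials`
(part II). The remaining three of the "five files" announced there (named
`HasseManinRecursion`, `HasseManinLocal`, `HasseManin` in the header of part II) are the three
sections `PartIII`, `PartIV`, `PartV` of this single module, which contains theorems only:

* **Part III — the basic identity.** For a point `P` of `W` over `L = F(W)` with `x(P) = a/b ∈ F(X)`
  in lowest terms, `deg b < deg a`, `P ≠ ±Q`, the reduced fractions `u₁/v₁ = x(P + Q)`,
  `u₂/v₂ = x(P - Q)` satisfy `deg u₁ + deg u₂ = 2 deg a + 2`, `deg vᵢ < deg uᵢ`, `v₁v₂ ~ (a - Xb)²`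
  (`step`; for `P = P_n` this is Manin's basic identity `d_{n-1} + d_{n+1} = 2d_n + 2`,
  Chahal 2021, (10.25); Chahal–Soomro–Top 2014, Lemma 1.1 (3)); `x(2Q) = Φ₂/Ψ₂Sq` in lowest terms
  (`isRep_xc_two_genPt`); the case `n = 0` (`step_zero`: `deg u₊ + deg u₋ = 2q + 2`,
  `deg u± = deg v± + 1`, `v₊v₋ ~ (X^q - X)²`).
* **Part IV — `d₋₁ = #W(F)`.** The reduced denominator `v₋` of `x(P₀ - Q)` has degree equal to
  the number of affine `F`-points of `W` (`natDegree_eq_card_affine`; Chahal 2021, Thm. 10.13;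
  Chahal–Soomro–Top 2014, Lemma 1.1 (2)), by computing the multiplicity of each `α ∈ F` in `v₋`
  in the fibre algebra `F[Y]/(W(α, Y))` (three cases: no, one or two rational points over `α`) —
  this replaces Euler's criterion in Manin's treatment and works in every characteristic.
* **Part V — the induction and the bound.** The invariant `St n` (`P_n = O ∧ d(n) = 0`, or the
  reduced numerator of `x(P_n)` has degree `d(n) = n² + (q + 1 - #W(F)) n + q`, larger than that
  of the denominator) for all `n ∈ ℤ` (`st_all`; Chahal 2021, Thm. 10.14), hence `d(n) ≥ 0` and
  `d(n) = 0 ⇒ d(n + 1) = 1`, and an integer endgame (`sq_le_four_mul`) gives `a² ≤ 4q`: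
  **Hasse's theorem** `abs_card_sub_le : |#W(F) - (q + 1)| ≤ 2√q` for every elliptic curve over
  every finite field. The named facts `Literature.NumberTheory.LFunctions.hasse_bound` and `Literature.NumberTheory.EllipticCurves.hasse_bound` are
  discharged from it in `Literature.NumberTheory.LFunctions.RHWave0HasseProofs` and
  `Literature.NumberTheory.EllipticCurves.BSDWave0HasseProofs`.

## References

* Ju. I. Manin, *On cubic congruences to a prime modulus*, Izv. Akad. Nauk SSSR 20 (1956).
* J. S. Chahal, *Algebraic Number Theory: A Brief Introduction*, CRC Press 2021, §10.3
  (pp. 141–148): (10.25), Thm. 10.12, Thm. 10.13 with its proof, Thm. 10.14 and "Proof of the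
  Riemann Hypothesis".
* J. S. Chahal, A. Soomro, J. Top, *A supplement to Manin's proof of the Hasse inequality*, Rocky
  Mountain J. Math. 44 (2014), §1, Lemma 1.1.
* J. H. Silverman, *The Arithmetic of Elliptic Curves*, 2nd ed., GTM 106, 2009, III.2.3,
  Exercise 3.1, Thm. V.1.1.
-/

noncomputable section

open Polynomial WeierstrassCurve WeierstrassCurve.Affine
open scoped Polynomial.Bivariate

namespace Literature.NumberTheory.EllipticCurves.HasseManin

universe u

section PartIII

/-! ## Part III: the basic identity

For a point `P = (x₁, y₁)` of `W` over `L = F(W)` with `x₁ = a/b ∈ F(X)` in lowest terms,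
`deg b < deg a`, and `P ≠ ±Q` (`Q = (t, s)` the generic point), the reduced numerators `u₁, u₂`
and denominators `v₁, v₂` of `x(P + Q)`, `x(P - Q)` satisfy `deg u₁ + deg u₂ = 2 deg a + 2`,
`deg vᵢ < deg uᵢ`, `v₁ v₂ ~ (a - Xb)²` (`step`). Applied to `P = P_n` this is Manin's
*basic identity* `d_{n-1} + d_{n+1} = 2 d_n + 2` (Chahal 2021, (10.25); Chahal–Soomro–Top 2014,
Lemma 1.1 (3)). The proof clears denominators in the `x`-only formulas of file II
(`sum_prod_mul_polyD`) and controls the cancellation by the primitivity of `(D, S, M)`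
(`isUnit_of_dvd_polyDSM`, from Stoll's certificate for Mathlib's `addSubMap`) and the
Gauss-lemma statement `exists_unit_of_pair`.

Also in this part: `x(2Q)` in lowest terms (`isRep_xc_two_genPt`, whence `d(±2Q) = 4`), and the
case `n = 0` of the identity (`step_zero`): for `x(P₀ ± Q) = u±/v±` in lowest terms,
`deg u₊ + deg u₋ = 2q + 2`, `deg u± = deg v± + 1`, and `v₊ v₋ ~ (X^q - X)²`. -/

variable {F : Type u} [Field F] (W : WeierstrassCurve F) [W.IsElliptic]

omit [W.IsElliptic] in
/-- `D(a, b) = (a - t b)²` in `F(W)`. [folklore] -/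
theorem algebraMap_polyD (a b : F[X]) :
    algebraMap F[X] W.toAffine.FunctionField (polyD W a b) =
      (algebraMap F[X] W.toAffine.FunctionField a -
        gT W * algebraMap F[X] W.toAffine.FunctionField b) ^ 2 := by
  rw [polyD_eq, map_pow, map_sub, map_mul, gT]

omit [W.IsElliptic] in
/-- The image of `S(a, b)` in `F(W)`. [folklore] -/
theorem algebraMap_polyS (a b : F[X]) :
    algebraMap F[X] W.toAffine.FunctionField (polyS W a b) =
      2 * (algebraMap F[X] W.toAffine.FunctionField a +
            gT W * algebraMap F[X] W.toAffine.FunctionField b) *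
          (algebraMap F[X] W.toAffine.FunctionField a * gT W) +
        algebraMap F _ W.b₂ * (algebraMap F[X] W.toAffine.FunctionField a * gT W) *
          algebraMap F[X] W.toAffine.FunctionField b +
        algebraMap F _ W.b₄ * (algebraMap F[X] W.toAffine.FunctionField a +
            gT W * algebraMap F[X] W.toAffine.FunctionField b) *
          algebraMap F[X] W.toAffine.FunctionField b +
        algebraMap F _ W.b₆ * algebraMap F[X] W.toAffine.FunctionField b ^ 2 := by
  simp only [polyS_eq, map_add, map_mul, map_pow, map_ofNat, algebraMap_C, gT]

omit [W.IsElliptic] in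
/-- The image of `M(a, b)` in `F(W)`. [folklore] -/
theorem algebraMap_polyM (a b : F[X]) :
    algebraMap F[X] W.toAffine.FunctionField (polyM W a b) =
      (algebraMap F[X] W.toAffine.FunctionField a * gT W) ^ 2 -
        algebraMap F _ W.b₄ * (algebraMap F[X] W.toAffine.FunctionField a * gT W) *
          algebraMap F[X] W.toAffine.FunctionField b -
        algebraMap F _ W.b₆ * (algebraMap F[X] W.toAffine.FunctionField a +
            gT W * algebraMap F[X] W.toAffine.FunctionField b) *
          algebraMap F[X] W.toAffine.FunctionField b -
        algebraMap F _ W.b₈ * algebraMap F[X] W.toAffine.FunctionField b ^ 2 := by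
  simp only [polyM_eq, map_sub, map_add, map_mul, map_pow, algebraMap_C, gT]

/-! ### The basic identity: one step `P ↦ (P + Q, P - Q)` -/

/-- `x(P + Q)` for `P = (x₁, y₁)` with `x₁ ≠ t` and the generic point `Q = (t, s)` is given by the
chord formula. [cite: SilvermanAEC2009, III.2.3 (Group Law Algorithm)] -/
theorem xc_add_genPt {x₁ y₁ : W.toAffine.FunctionField}
    (h₁ : (W.baseChange W.toAffine.FunctionField).toAffine.Nonsingular x₁ y₁) (hx : x₁ ≠ gT W) :
    xc W (.some x₁ y₁ h₁ + genPt W) =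
      (W.baseChange W.toAffine.FunctionField).toAffine.addX x₁ (gT W)
        ((W.baseChange W.toAffine.FunctionField).toAffine.slope x₁ (gT W) y₁ (gS W)) := by
  rw [genPt, Point.add_of_X_ne hx, xc_some]

/-- `x(P - Q)` for `P = (x₁, y₁)` with `x₁ ≠ t` is given by the chord formula for `P` and `-Q = (t,
-s - a₁t - a₃)`. [cite: SilvermanAEC2009, III.2.3 (Group Law Algorithm)] -/
theorem xc_sub_genPt {x₁ y₁ : W.toAffine.FunctionField}
    (h₁ : (W.baseChange W.toAffine.FunctionField).toAffine.Nonsingular x₁ y₁) (hx : x₁ ≠ gT W) :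
    xc W (.some x₁ y₁ h₁ - genPt W) =
      (W.baseChange W.toAffine.FunctionField).toAffine.addX x₁ (gT W)
        ((W.baseChange W.toAffine.FunctionField).toAffine.slope x₁ (gT W) y₁
          ((W.baseChange W.toAffine.FunctionField).toAffine.negY (gT W) (gS W))) := by
  rw [sub_eq_add_neg, genPt, Point.neg_some, Point.add_of_X_ne hx, xc_some]

/-- The `x`-only formulas for `P ± Q`, `Q = (t, s)` the generic point, cleared of denominators: if
`x(P) = a/b` then `(x(P + Q) + x(P - Q)) · D(a, b) = S(a, b)` and `x(P + Q) · x(P - Q) · D(a, b) =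
M(a, b)` in `F(W)`. [folklore] -/
theorem sum_prod_mul_polyD {x₁ y₁ : W.toAffine.FunctionField}
    (h₁ : (W.baseChange W.toAffine.FunctionField).toAffine.Nonsingular x₁ y₁) {a b : F[X]}
    (hrep : IsRep W x₁ a b) (hx : x₁ ≠ gT W) :
    (xc W (.some x₁ y₁ h₁ + genPt W) + xc W (.some x₁ y₁ h₁ - genPt W)) *
          algebraMap F[X] W.toAffine.FunctionField (polyD W a b) =
        algebraMap F[X] W.toAffine.FunctionField (polyS W a b) ∧
      xc W (.some x₁ y₁ h₁ + genPt W) * xc W (.some x₁ y₁ h₁ - genPt W) *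
          algebraMap F[X] W.toAffine.FunctionField (polyD W a b) =
        algebraMap F[X] W.toAffine.FunctionField (polyM W a b) := by
  have hQ := equation_gT_gS W
  have hsum := addX_add_addX_negY_mul_sq h₁.left hQ hx
  have hprod := addX_mul_addX_negY_mul_pow_four h₁.left hQ hx
  rw [← xc_add_genPt W h₁ hx, ← xc_sub_genPt W h₁ hx] at hsum hprod
  have hxt : x₁ - gT W ≠ 0 := sub_ne_zero.mpr hx
  have hprod' : xc W (.some x₁ y₁ h₁ + genPt W) * xc W (.some x₁ y₁ h₁ - genPt W) *
      (x₁ - gT W) ^ 2 = x₁ ^ 2 * gT W ^ 2 -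
        (W.baseChange W.toAffine.FunctionField).toAffine.b₄ * x₁ * gT W -
        (W.baseChange W.toAffine.FunctionField).toAffine.b₆ * (x₁ + gT W) -
        (W.baseChange W.toAffine.FunctionField).toAffine.b₈ := by
    apply mul_left_cancel₀ (pow_ne_zero 2 hxt)
    linear_combination hprod
  rw [baseChange_b₂', baseChange_b₄', baseChange_b₆'] at hsum
  rw [baseChange_b₄', baseChange_b₆', baseChange_b₈'] at hprod'
  have ha : algebraMap F[X] W.toAffine.FunctionField a =
      x₁ * algebraMap F[X] W.toAffine.FunctionField b := hrep.mul_eq.symm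
  constructor
  · rw [algebraMap_polyD, algebraMap_polyS, ha]
    linear_combination (algebraMap F[X] W.toAffine.FunctionField b) ^ 2 * hsum
  · rw [algebraMap_polyD, algebraMap_polyM, ha]
    linear_combination (algebraMap F[X] W.toAffine.FunctionField b) ^ 2 * hprod'

/-- **Manin's basic identity (one step).** Let `P = (x₁, y₁)` be a point of `W` over `F(W)` whose
`x`-coordinate is `a/b ∈ F(X)` in lowest terms with `deg b < deg a`, and assume `x₁ ≠ t` (i.e. `P ≠
±Q` for the generic point `Q = (t, s)`). If `x(P + Q) = u₁/v₁` and `x(P - Q) = u₂/v₂` in lowest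
terms, then `deg u₁ + deg u₂ = 2 deg a + 2`, `deg v₁ + deg v₂ = deg D(a, b)`, `deg vᵢ < deg uᵢ`, and
`v₁ v₂` is a unit multiple of `D(a, b) = (a - Xb)²`. For `P = P_n` this is `d_{n-1} + d_{n+1} = 2
d_n + 2`. [cite: Chahal2021, §10.3 (10.25) (Basic Identity)] -/
theorem step {x₁ y₁ : W.toAffine.FunctionField}
    (h₁ : (W.baseChange W.toAffine.FunctionField).toAffine.Nonsingular x₁ y₁) {a b : F[X]}
    (hrep : IsRep W x₁ a b) (hdeg : b.natDegree < a.natDegree) (hx : x₁ ≠ gT W)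
    {u₁ v₁ u₂ v₂ : F[X]} (hadd : IsRep W (xc W (.some x₁ y₁ h₁ + genPt W)) u₁ v₁)
    (hsub : IsRep W (xc W (.some x₁ y₁ h₁ - genPt W)) u₂ v₂) :
    u₁.natDegree + u₂.natDegree = 2 * a.natDegree + 2 ∧
      v₁.natDegree + v₂.natDegree = (polyD W a b).natDegree ∧ v₁.natDegree < u₁.natDegree ∧
      v₂.natDegree < u₂.natDegree ∧ ∃ c : F[X], IsUnit c ∧ v₁ * v₂ * c = polyD W a b := by
  obtain ⟨hSL, hML⟩ := sum_prod_mul_polyD W h₁ hrep hx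
  have hinj := algebraMap_functionField_injective W
  have hS : polyD W a b * (u₁ * v₂ + u₂ * v₁) = polyS W a b * (v₁ * v₂) := by
    apply hinj
    simp only [map_mul, map_add]
    rw [← hadd.mul_eq, ← hsub.mul_eq, ← hSL]
    ring
  have hM : polyD W a b * (u₁ * u₂) = polyM W a b * (v₁ * v₂) := by
    apply hinj
    simp only [map_mul]
    rw [← hadd.mul_eq, ← hsub.mul_eq, ← hML]
    ring
  obtain ⟨c, hc, hvD, huM, hcross⟩ := exists_unit_of_pair hadd.isCoprime hsub.isCoprime
    hadd.ne_zero hsub.ne_zero (fun p hD hS' hM' => isUnit_of_dvd_polyDSM hrep.isCoprime hD hS' hM')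
    hS hM
  obtain ⟨hu, hv, hv₁, hv₂⟩ := natDegree_of_pair hadd.ne_zero hsub.ne_zero hc hvD huM hcross
    (natDegree_polyD_le hdeg) (natDegree_polyS_le hdeg) (natDegree_polyM hdeg)
  exact ⟨hu, hv, hv₁, hv₂, c, hc, hvD⟩

/-! ### Doubling the generic point -/

/-- `s ≠ -s - a₁t - a₃`: the generic point is not a point of order `2` (as `2Y + a₁X + a₃ ≠ 0` in
`F[W]`, which uses `Δ ≠ 0` in characteristic `2`). [folklore] -/
theorem gS_ne_negY :
    gS W ≠ (W.baseChange W.toAffine.FunctionField).toAffine.negY (gT W) (gS W) := by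
  intro h
  rw [baseChange_negY, ← sub_eq_zero] at h
  have h1 : algebraMap W.toAffine.CoordinateRing W.toAffine.FunctionField
      (2 * CoordinateRing.mk W.toAffine Y + algebraMap F[X] _ (C W.a₁ * X + C W.a₃)) = 0 := by
    rw [map_add, map_mul, ← IsScalarTower.algebraMap_apply, algebraMap_linTerm, map_ofNat, ← h]
    simp only [gS, gT]
    ring
  have h2 := eq_zero_of_mul_two_Y_add W 1 (by
    rw [map_one, one_mul]
    exact (map_eq_zero_iff _
      (IsFractionRing.injective W.toAffine.CoordinateRing W.toAffine.FunctionField)).mp h1)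
  exact one_ne_zero h2

/-- `2Q ≠ O` for the generic point `Q`. [folklore] -/
theorem genPt_add_genPt_ne_zero : genPt W + genPt W ≠ 0 := by
  rw [genPt, Point.add_self_of_Y_ne (gS_ne_negY W)]
  exact Point.some_ne_zero _

omit [W.IsElliptic] in
/-- `p(t) = p` in `F(W)`: evaluating `p ∈ F[X]` at `t` is the structure map `F[X] → F(W)`.
[folklore] -/
theorem aeval_gT (p : F[X]) : aeval (gT W) p = algebraMap F[X] W.toAffine.FunctionField p := by
  have h := aeval_algHom_apply (IsScalarTower.toAlgHom F F[X] W.toAffine.FunctionField) X p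
  rwa [aeval_X_left_apply] at h

omit [W.IsElliptic] in
/-- `Φ₂(x) = x · Ψ₂Sq(x) - Ψ₃(x)` (`φ₂ = xψ₂² - ψ₃ψ₁`), for Mathlib's univariate `Φ 2`, `Ψ₂Sq`,
`Ψ₃`. [folklore] -/
theorem eval_Φ_two (V : WeierstrassCurve W.toAffine.FunctionField)
    (x : W.toAffine.FunctionField) :
    (V.Φ 2).eval x = x * V.Ψ₂Sq.eval x - V.Ψ₃.eval x := by
  simp only [WeierstrassCurve.Φ_two, WeierstrassCurve.Ψ₂Sq, WeierstrassCurve.Ψ₃, eval_sub,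
    eval_add, eval_mul, eval_pow, eval_C, eval_X, eval_ofNat]
  ring

/-- `x(2Q) = Φ₂ / Ψ₂Sq = (X⁴ - b₄X² - 2b₆X - b₈) / (4X³ + b₂X² + 2b₄X + b₆)` *in lowest terms* for
the generic point `Q = (t, s)`: the duplication formula (Silverman III.2.3(d)) in the form
`WeierstrassCurve.addX_self_sub_mul_sq` of
`Literature.NumberTheory.EllipticCurves.DivisionPolynomialTorsion` (`(x(2P) - x) ψ₂² = -Ψ₃(x)`)
together with `ψ₂² = Ψ₂Sq(x)` (`WeierstrassCurve.sub_negY_sq_eq_eval_Ψ₂Sq` of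
`TorsionCardinality`), the non-vanishing `WeierstrassCurve.Ψ₂Sq_ne_zero_of_isElliptic` of
`TwoTorsion` (every characteristic) and the coprimality `isCoprime_Φ_two_ΨSq_two` of file II
(`Δ ≠ 0`); in particular `d(±2Q) = deg Φ₂ = 4`.
[cite: SilvermanAEC2009, III.2.3(d) and Exercise 3.1] -/
theorem isRep_xc_two_genPt : IsRep W (xc W (genPt W + genPt W)) (W.Φ 2) W.Ψ₂Sq := by
  refine ⟨W.Ψ₂Sq_ne_zero_of_isElliptic,
    by simpa only [WeierstrassCurve.ΨSq_two] using isCoprime_Φ_two_ΨSq_two (W := W), ?_⟩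
  rw [genPt, Point.add_self_of_Y_ne (gS_ne_negY W), xc_some]
  have hQ := equation_gT_gS W
  have h2 : _ = (W.baseChange W.toAffine.FunctionField).Ψ₂Sq.eval (gT W) :=
    (W.baseChange W.toAffine.FunctionField).sub_negY_sq_eq_eval_Ψ₂Sq hQ
  have h1 : (W.baseChange W.toAffine.FunctionField).toAffine.addX (gT W) (gT W)
        ((W.baseChange W.toAffine.FunctionField).toAffine.slope (gT W) (gT W) (gS W) (gS W)) *
      (gS W - (W.baseChange W.toAffine.FunctionField).toAffine.negY (gT W) (gS W)) ^ 2 =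
      ((W.baseChange W.toAffine.FunctionField).Φ 2).eval (gT W) := by
    rw [eval_Φ_two, ← h2]
    linear_combination addX_self_sub_mul_sq hQ (gS_ne_negY W)
  rw [h2, WeierstrassCurve.baseChange, WeierstrassCurve.map_Φ, WeierstrassCurve.map_Ψ₂Sq,
    eval_map_algebraMap, eval_map_algebraMap, aeval_gT, aeval_gT] at h1
  exact h1

/-- The basic identity at `n = 0`: if `x(P₀ + Q) = u₊/v₊` and `x(P₀ - Q) = u₋/v₋` in lowest terms
(`P₀ = (t^q, s^q)`, `Q = (t, s)`), then `deg u₊ + deg u₋ = 2q + 2`, `deg u± = deg v± + 1`, and `v₊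
v₋` is a unit multiple of `(X^q - X)²` (the common denominator `(t^q - t)²` of the chord formulas;
compare the displayed formula (10.27) for `x(P₋₁)` in Chahal's account).
[cite: Chahal2021, §10.3 proof of Thm. 10.13, (10.27)] -/
theorem step_zero [Fintype F] {u₁ v₁ u₂ v₂ : F[X]}
    (hadd : IsRep W (xc W (frobPt W + genPt W)) u₁ v₁)
    (hsub : IsRep W (xc W (frobPt W - genPt W)) u₂ v₂) :
    u₁.natDegree + u₂.natDegree = 2 * Fintype.card F + 2 ∧
      u₁.natDegree = v₁.natDegree + 1 ∧ u₂.natDegree = v₂.natDegree + 1 ∧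
      ∃ c : F[X], IsUnit c ∧ v₁ * v₂ * c = (X ^ Fintype.card F - X) ^ 2 := by
  have hdeg : (1 : F[X]).natDegree < (X ^ Fintype.card F : F[X]).natDegree := by
    rw [natDegree_one, natDegree_X_pow]; exact Fintype.card_pos
  have hD : polyD W (X ^ Fintype.card F) 1 = (X ^ Fintype.card F - X) ^ 2 := by
    rw [polyD_eq, mul_one]
  have hDdeg : (polyD W (X ^ Fintype.card F) 1).natDegree = 2 * Fintype.card F := by
    rw [hD, natDegree_pow, FiniteField.X_pow_card_sub_X_natDegree_eq F Fintype.one_lt_card]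
  rw [frobPt_eq] at hadd hsub
  obtain ⟨hu, hv, hv₁, hv₂, c, hc, hvD⟩ :=
    step W (nonsingular_frob W) (isRep_xc_frobPt W) hdeg (gT_pow_card_ne_gT W) hadd hsub
  rw [hDdeg] at hv
  rw [natDegree_X_pow] at hu
  refine ⟨hu, by omega, by omega, c, hc, ?_⟩
  rw [hvD, hD]

end PartIII

section PartIV

/-! ## Part IV: the fibres of `x` and `d₋₁ = #W(F)`

We show that the reduced denominator `v₋` of `x(P₀ - Q)` has degree equal to the number of
affine `F`-rational points of `W` (`natDegree_eq_card_affine`); together with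
`deg u₋ = deg v₋ + 1` (Part III, `step_zero`) this is `d₋₁ = #W(F)` (Chahal 2021, Thm. 10.13;
Chahal–Soomro–Top 2014, Lemma 1.1 (2)). By Part III, `v₊ v₋ ~ (X^q - X)² = ∏_α (X - α)²`, and
`x(P₀ ± Q) · (t^q - t)² = ν(u±)` where `ν(u±) ∈ F[W]` is in fact a polynomial `p± ∈ F[X]` with
`p± v± = u± (X^q - X)²` (`exists_eq_algebraMap_of_isRep`). Evaluating in the fibre algebra
`B_α = F[Y]/(W(α, Y))` (file I) gives `p±(α) = (ev_α u±)²` with `ev_α u₊ = Ȳ^q - Ȳ` and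
`ev_α u₋ = Ȳ^q + Ȳ + a₁α + a₃`. The three cases — no, exactly one, or two rational points over
`α`, i.e. `B_α` a field, `(Ȳ - y₀)² = 0` in `B_α`, or `W(α, Y) = (Y - y₁)(Y - y₂)` — give
`ν₊(α) ≠ 0`, `ν₊(α) = ν₋(α) = 0`, `ν₋(α) ≠ 0` respectively, whence the multiplicity of `α` in
`v₋` is `0, 1, 2` = the number of rational points over `α` (`rootMultiplicity_eq_card_fibre`).
This replaces Euler's criterion in Manin's treatment of `d₋₁` (Chahal 2021, proof of
Thm. 10.13, where the characteristic is odd and the curve is in short Weierstrass form) and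
works in every characteristic. -/

variable {F : Type u} [Field F] [Fintype F] (W : WeierstrassCurve F)

/-! ### `x(P₀ ± Q) · (t^q - t)²` as elements of `F[W]` -/

/-- `x(P₀ + Q) · (t^q - t)² = ν(u₊)` with `u₊ = s^q - s`: the chord formula for `P₀ = (t^q, s^q)`
and `Q = (t, s)` with slope `(s^q - s)/(t^q - t)`, cleared of denominators. [folklore] -/
theorem xc_frobPt_add_genPt_mul [W.IsElliptic] :
    xc W (frobPt W + genPt W) *
        algebraMap F[X] W.toAffine.FunctionField ((X ^ Fintype.card F - X) ^ 2) =
      algebraMap W.toAffine.CoordinateRing W.toAffine.FunctionField (nu W (uPlus W)) := by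
  rw [frobPt_eq, xc_add_genPt W (nonsingular_frob W) (gT_pow_card_ne_gT W),
    slope_of_X_ne (gT_pow_card_ne_gT W), map_pow, map_sub, map_pow, ← gT,
    addX_div_mul_sq _ _ _ (sub_ne_zero.mpr (gT_pow_card_ne_gT W)), algebraMap_nu, algebraMap_uPlus]
  rfl

/-- `x(P₀ - Q) · (t^q - t)² = ν(u₋)` with `u₋ = s^q + s + a₁t + a₃`: the chord formula for `P₀` and
`-Q`, cleared of denominators (compare (10.27) in Chahal's account, for the twisted short
Weierstrass model). [cite: Chahal2021, §10.3 proof of Thm. 10.13, (10.27)] -/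
theorem xc_frobPt_sub_genPt_mul [W.IsElliptic] :
    xc W (frobPt W - genPt W) *
        algebraMap F[X] W.toAffine.FunctionField ((X ^ Fintype.card F - X) ^ 2) =
      algebraMap W.toAffine.CoordinateRing W.toAffine.FunctionField (nu W (uMinus W)) := by
  rw [frobPt_eq, xc_sub_genPt W (nonsingular_frob W) (gT_pow_card_ne_gT W),
    slope_of_X_ne (gT_pow_card_ne_gT W), map_pow, map_sub, map_pow, ← gT,
    addX_div_mul_sq _ _ _ (sub_ne_zero.mpr (gT_pow_card_ne_gT W)), algebraMap_nu, algebraMap_uMinus]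
  rfl

/-! ### `ν` is a polynomial in `X` carrying the reduced denominator -/

omit [Fintype F] in
/-- Comparing coefficients with respect to the `F[X]`-basis `{1, Y}` of `F[W]`. [folklore] -/
theorem add_mul_Y_inj {p₁ q₁ p₂ q₂ : F[X]}
    (h : algebraMap F[X] W.toAffine.CoordinateRing p₁ +
        algebraMap F[X] W.toAffine.CoordinateRing q₁ * CoordinateRing.mk W.toAffine Y =
      algebraMap F[X] W.toAffine.CoordinateRing p₂ +
        algebraMap F[X] W.toAffine.CoordinateRing q₂ * CoordinateRing.mk W.toAffine Y) :
    p₁ = p₂ ∧ q₁ = q₂ := by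
  have h' : algebraMap F[X] W.toAffine.CoordinateRing (p₁ - p₂) +
      algebraMap F[X] W.toAffine.CoordinateRing (q₁ - q₂) * CoordinateRing.mk W.toAffine Y = 0 := by
    rw [map_sub, map_sub]; linear_combination h
  obtain ⟨h1, h2⟩ := eq_zero_of_add_mul_Y_eq_zero W h'
  exact ⟨sub_eq_zero.mp h1, sub_eq_zero.mp h2⟩

omit [Fintype F] in
/-- If `z ∈ F(W)` has the reduced representation `u / v` (`u, v ∈ F[X]`) and `z · δ`, `δ ∈ F[X]`, is
the image of `ν ∈ F[W]`, then `ν` is (the image of) a polynomial `p ∈ F[X]` with `p v = u δ`.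
[folklore] -/
theorem exists_eq_algebraMap_of_isRep {z : W.toAffine.FunctionField} {ν : W.toAffine.CoordinateRing}
    {δ u v : F[X]}
    (hz : z * algebraMap F[X] W.toAffine.FunctionField δ =
      algebraMap W.toAffine.CoordinateRing W.toAffine.FunctionField ν) (hrep : IsRep W z u v) :
    ∃ p : F[X], ν = algebraMap F[X] W.toAffine.CoordinateRing p ∧ p * v = u * δ := by
  have hinj := IsFractionRing.injective W.toAffine.CoordinateRing W.toAffine.FunctionField
  have key : ν * algebraMap F[X] W.toAffine.CoordinateRing v =
      algebraMap F[X] W.toAffine.CoordinateRing (u * δ) := by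
    apply hinj
    rw [map_mul, ← hz]
    simp only [map_mul, ← IsScalarTower.algebraMap_apply]
    rw [← hrep.mul_eq]
    ring
  obtain ⟨p, r, hpr⟩ := exists_eq_add_mul_Y W ν
  rw [hpr, add_mul, mul_right_comm, ← map_mul, ← map_mul] at key
  obtain ⟨h1, h2⟩ :=
    add_mul_Y_inj W (p₂ := u * δ) (q₂ := 0) (by rw [key, map_zero, zero_mul, add_zero])
  have hr : r = 0 := (mul_eq_zero.mp h2).resolve_right hrep.ne_zero
  exact ⟨p, by rw [hpr, hr, map_zero, zero_mul, add_zero], h1⟩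

/-! ### The polynomial `X^q - X` -/

/-- `X^q - X` splits over `F` (`q = #F`). [folklore] -/
theorem splits_X_pow_card_sub_X : Splits (X ^ Fintype.card F - X : F[X]) := by
  rw [splits_iff_card_roots, FiniteField.roots_X_pow_card_sub_X, ← Finset.card_def,
    Finset.card_univ, FiniteField.X_pow_card_sub_X_natDegree_eq F Fintype.one_lt_card]

/-- `X^q - X` is monic. [folklore] -/
theorem monic_X_pow_card_sub_X : (X ^ Fintype.card F - X : F[X]).Monic :=
  monic_X_pow_sub (by rw [degree_X]; exact_mod_cast Fintype.one_lt_card)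

/-- `X^q - X = ∏_{β ∈ F} (X - β)`: the elements of `F` are exactly the roots of `X^q - X`.
[cite: Chahal2021, §10.3 Thm. 10.12 (iii)] -/
theorem X_pow_card_sub_X_eq_prod : (X ^ Fintype.card F - X : F[X]) = ∏ β : F, (X - C β) := by
  have h := (splits_X_pow_card_sub_X (F := F)).eq_prod_roots_of_monic monic_X_pow_card_sub_X
  rw [FiniteField.roots_X_pow_card_sub_X] at h
  exact h

/-- Every `α ∈ F` is a root of `(X^q - X)²` of multiplicity exactly `2`. [folklore] -/
theorem rootMultiplicity_X_pow_card_sub_X_sq (α : F) :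
    rootMultiplicity α ((X ^ Fintype.card F - X : F[X]) ^ 2) = 2 := by
  classical
  rw [← count_roots, roots_pow, Multiset.count_nsmul, FiniteField.roots_X_pow_card_sub_X,
    Multiset.count_univ, mul_one]

section Fibre

variable (α : F)

/-- If `ν(u) ∈ F[W]` is the image of `p ∈ F[X]`, then `p(α) = (ev_α u)²` in the fibre algebra over
`α` (as `ev_α δ = 0`). [folklore] -/
theorem algebraMap_eval_eq_sq {v : W.toAffine.CoordinateRing} {p : F[X]}
    (h : nu W v = algebraMap F[X] W.toAffine.CoordinateRing p) :
    algebraMap F (AdjoinRoot (fibPoly W α)) (p.eval α) = evA W α v ^ 2 := by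
  rw [← evA_algebraMap, ← h, evA_nu]

/-! #### Frobenius on the fibre algebra -/

/-- Additivity of the `q`-power map on the fibre algebra (an `F`-algebra, `q = #F`).
[cite: Chahal2021, §10.3 Thm. 10.12 (ii)] -/
theorem add_pow_card (x y : AdjoinRoot (fibPoly W α)) :
    (x + y) ^ Fintype.card F = x ^ Fintype.card F + y ^ Fintype.card F := by
  have h := map_add (FiniteField.frobeniusAlgHom F (AdjoinRoot (fibPoly W α))) x y
  simpa only [FiniteField.coe_frobeniusAlgHom] using h

/-- `(x - y)^q = x^q - y^q` on the fibre algebra. [cite: Chahal2021, §10.3 Thm. 10.12 (ii)] -/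
theorem sub_pow_card (x y : AdjoinRoot (fibPoly W α)) :
    (x - y) ^ Fintype.card F = x ^ Fintype.card F - y ^ Fintype.card F := by
  have h := map_sub (FiniteField.frobeniusAlgHom F (AdjoinRoot (fibPoly W α))) x y
  simpa only [FiniteField.coe_frobeniusAlgHom] using h

/-- `a^q = a` for `a ∈ F` (in the fibre algebra). [cite: Chahal2021, §10.3 Thm. 10.12 (iii)]
-/
theorem algebraMap_pow_card (a : F) :
    algebraMap F (AdjoinRoot (fibPoly W α)) a ^ Fintype.card F = algebraMap F _ a := by
  rw [← map_pow, FiniteField.pow_card]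

/-! #### Case of two rational points in the fibre -/

omit [Fintype F] in
/-- Two distinct rational points `(α, y₁)`, `(α, y₂)` over `α`: Vieta's formulas `a₁α + a₃ = -(y₁ +
y₂)` and `α³ + a₂α² + a₄α + a₆ = -y₁y₂`. [folklore] -/
theorem vieta_of_two {y₁ y₂ : F} (hne : y₁ ≠ y₂) (h₁ : W.toAffine.Equation α y₁)
    (h₂ : W.toAffine.Equation α y₂) :
    W.a₁ * α + W.a₃ = -(y₁ + y₂) ∧ α ^ 3 + W.a₂ * α ^ 2 + W.a₄ * α + W.a₆ = -(y₁ * y₂) := by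
  rw [← eval_fibPoly_eq_zero_iff, eval_fibPoly] at h₁ h₂
  have hsum : W.a₁ * α + W.a₃ = -(y₁ + y₂) := by
    have h : (y₁ - y₂) * (y₁ + y₂ + (W.a₁ * α + W.a₃)) = 0 := by linear_combination h₁ - h₂
    have := (mul_eq_zero.mp h).resolve_left (sub_ne_zero.mpr hne)
    linear_combination this
  exact ⟨hsum, by linear_combination -h₁ + y₁ * hsum⟩

omit [Fintype F] in
/-- Two distinct rational points over `α`: `W(α, Y) = (Y - y₁)(Y - y₂)`. [folklore] -/
theorem fibPoly_eq_mul_of_two {y₁ y₂ : F} (hne : y₁ ≠ y₂) (h₁ : W.toAffine.Equation α y₁)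
    (h₂ : W.toAffine.Equation α y₂) : fibPoly W α = (X - C y₁) * (X - C y₂) := by
  obtain ⟨hs, hp⟩ := vieta_of_two W α hne h₁ h₂
  rw [fibPoly, hs, hp]
  simp only [map_neg, map_add, map_mul]
  ring

/-- Two distinct rational points over `α`: `Ȳ^q = Ȳ` in `F[Y]/(W(α, Y))` (as `W(α, Y)` divides `Y^q
- Y`). [folklore] -/
theorem root_pow_card_of_two {y₁ y₂ : F} (hne : y₁ ≠ y₂) (h₁ : W.toAffine.Equation α y₁)
    (h₂ : W.toAffine.Equation α y₂) :
    AdjoinRoot.root (fibPoly W α) ^ Fintype.card F = AdjoinRoot.root (fibPoly W α) := by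
  classical
  have hdvd : fibPoly W α ∣ X ^ Fintype.card F - X := by
    rw [fibPoly_eq_mul_of_two W α hne h₁ h₂, X_pow_card_sub_X_eq_prod,
      ← Finset.prod_pair (f := fun y : F => (X - C y : F[X])) hne]
    exact Finset.prod_dvd_prod_of_subset _ _ _ (Finset.subset_univ _)
  have h := AdjoinRoot.mk_eq_zero.mpr hdvd
  rwa [map_sub, map_pow, AdjoinRoot.mk_X, sub_eq_zero] at h

/-- Two distinct rational points over `α`: `ν₋(α) = (2Ȳ + a₁α + a₃)² = (y₁ - y₂)² ≠ 0`, so no factor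
`X - α` cancels in `x(P₀ - Q)`. [folklore] -/
theorem eval_ne_zero_of_two {y₁ y₂ : F} (hne : y₁ ≠ y₂) (h₁ : W.toAffine.Equation α y₁)
    (h₂ : W.toAffine.Equation α y₂) {p : F[X]}
    (hp : nu W (uMinus W) = algebraMap F[X] W.toAffine.CoordinateRing p) : p.eval α ≠ 0 := by
  have key := algebraMap_eval_eq_sq W α hp
  rw [evA_uMinus, root_pow_card_of_two W α hne h₁ h₂] at key
  obtain ⟨hs, hpr⟩ := vieta_of_two W α hne h₁ h₂
  have hr := root_sq W α
  have hsq : (AdjoinRoot.root (fibPoly W α) + AdjoinRoot.root (fibPoly W α) +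
      algebraMap F _ (W.a₁ * α + W.a₃)) ^ 2 =
        algebraMap F (AdjoinRoot (fibPoly W α)) ((y₁ - y₂) ^ 2) := by
    rw [hs, hpr] at hr
    rw [hs]
    simp only [map_neg, map_add, map_mul, map_pow, map_sub] at hr ⊢
    linear_combination 4 * hr
  rw [hsq] at key
  rw [algebraMap_fibAlg_injective W α key]
  exact pow_ne_zero _ (sub_ne_zero.mpr hne)

/-! #### Case of no rational point in the fibre -/

omit [Fintype F] in
/-- No rational point over `α`: `W(α, Y)` is irreducible (degree `2` without roots). [folklore] -/
theorem irreducible_fibPoly_of_zero (h0 : ∀ y, ¬W.toAffine.Equation α y) :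
    Irreducible (fibPoly W α) := by
  rw [(monic_fibPoly W α).irreducible_iff_roots_eq_zero_of_degree_le_three
    (by rw [natDegree_fibPoly]) (by rw [natDegree_fibPoly]; norm_num),
    Multiset.eq_zero_iff_forall_notMem]
  intro y hy
  rw [mem_roots (fibPoly_ne_zero W α), IsRoot.def, eval_fibPoly_eq_zero_iff] at hy
  exact h0 y hy

omit [Fintype F] in
/-- No rational point over `α`: the fibre algebra `F[Y]/(W(α, Y))` is a domain (the field with `q²`
elements). [folklore] -/
theorem isDomain_fibAlg_of_zero (h0 : ∀ y, ¬W.toAffine.Equation α y) :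
    IsDomain (AdjoinRoot (fibPoly W α)) :=
  AdjoinRoot.isDomain_of_prime (irreducible_fibPoly_of_zero W α h0).prime

/-- No rational point over `α`: `Ȳ^q ≠ Ȳ` in the fibre algebra (otherwise `Ȳ` would be a root of
`X^q - X`, hence the image of some `β ∈ F`, and `(α, β)` would be a rational point). [folklore] -/
theorem root_pow_card_ne_root_of_zero (h0 : ∀ y, ¬W.toAffine.Equation α y) :
    AdjoinRoot.root (fibPoly W α) ^ Fintype.card F ≠ AdjoinRoot.root (fibPoly W α) := by
  haveI := isDomain_fibAlg_of_zero W α h0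
  intro h
  have hroot : ((X ^ Fintype.card F - X : F[X]).map
      (algebraMap F (AdjoinRoot (fibPoly W α)))).IsRoot (AdjoinRoot.root (fibPoly W α)) := by
    rw [IsRoot.def, eval_map, eval₂_sub, eval₂_X_pow, eval₂_X, h, sub_self]
  obtain ⟨β, hβ⟩ := RingHom.mem_range.mp ((splits_X_pow_card_sub_X (F := F)).mem_range_of_isRoot
    (FiniteField.X_pow_card_sub_X_ne_zero F Fintype.one_lt_card) hroot)
  apply h0 β
  rw [← eval_fibPoly_eq_zero_iff]
  apply algebraMap_fibAlg_injective W α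
  have h2 := AdjoinRoot.eval₂_root (fibPoly W α)
  rw [← hβ, AdjoinRoot.algebraMap_eq, eval₂_at_apply] at h2
  rw [map_zero, AdjoinRoot.algebraMap_eq]
  exact h2

/-- No rational point over `α`: `ν₊(α) = (Ȳ^q - Ȳ)² ≠ 0` (the fibre algebra being a domain), so no
factor `X - α` cancels in `x(P₀ + Q)`. [folklore] -/
theorem eval_ne_zero_of_zero (h0 : ∀ y, ¬W.toAffine.Equation α y) {p : F[X]}
    (hp : nu W (uPlus W) = algebraMap F[X] W.toAffine.CoordinateRing p) : p.eval α ≠ 0 := by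
  haveI := isDomain_fibAlg_of_zero W α h0
  have key := algebraMap_eval_eq_sq W α hp
  rw [evA_uPlus] at key
  intro h
  rw [h, map_zero, eq_comm, pow_eq_zero_iff two_ne_zero, sub_eq_zero] at key
  exact root_pow_card_ne_root_of_zero W α h0 key

/-! #### Case of exactly one rational point in the fibre -/

omit [Fintype F] in
/-- Exactly one rational point `(α, y₀)` over `α`: since the conjugate root `-(a₁α + a₃) - y₀` must
equal `y₀`, `a₁α + a₃ = -2y₀` and `α³ + a₂α² + a₄α + a₆ = -y₀²`. [folklore] -/
theorem coeffs_of_one {y₀ : F} (h₀ : W.toAffine.Equation α y₀)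
    (huniq : ∀ y, W.toAffine.Equation α y → y = y₀) :
    W.a₁ * α + W.a₃ = -(2 * y₀) ∧ α ^ 3 + W.a₂ * α ^ 2 + W.a₄ * α + W.a₆ = -(y₀ ^ 2) := by
  rw [← eval_fibPoly_eq_zero_iff, eval_fibPoly] at h₀
  have h₁ : W.toAffine.Equation α (-(W.a₁ * α + W.a₃) - y₀) := by
    rw [← eval_fibPoly_eq_zero_iff, eval_fibPoly]
    linear_combination h₀
  have hy := huniq _ h₁
  have hc : W.a₁ * α + W.a₃ = -(2 * y₀) := by linear_combination -hy
  exact ⟨hc, by linear_combination -h₀ + y₀ * hc⟩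

omit [Fintype F] in
/-- Exactly one rational point `(α, y₀)` over `α`: `(Ȳ - y₀)² = 0` in the fibre algebra. [folklore]
-/
theorem root_sub_sq_of_one {y₀ : F} (h₀ : W.toAffine.Equation α y₀)
    (huniq : ∀ y, W.toAffine.Equation α y → y = y₀) :
    (AdjoinRoot.root (fibPoly W α) - algebraMap F _ y₀) ^ 2 = 0 := by
  obtain ⟨hc, hf⟩ := coeffs_of_one W α h₀ huniq
  have hr := root_sq W α
  rw [hc, hf] at hr
  simp only [map_neg, map_mul, map_pow, map_ofNat] at hr
  linear_combination hr

/-- Exactly one rational point `(α, y₀)` over `α`: `Ȳ^q = y₀` in the fibre algebra (from `(Ȳ - y₀)²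
= 0` and `q ≥ 2`). [folklore] -/
theorem root_pow_card_of_one {y₀ : F} (h₀ : W.toAffine.Equation α y₀)
    (huniq : ∀ y, W.toAffine.Equation α y → y = y₀) :
    AdjoinRoot.root (fibPoly W α) ^ Fintype.card F = algebraMap F _ y₀ := by
  have hsq := root_sub_sq_of_one W α h₀ huniq
  obtain ⟨k, hk⟩ := Nat.exists_eq_add_of_le (Fintype.one_lt_card (α := F))
  have hzero : (AdjoinRoot.root (fibPoly W α) - algebraMap F _ y₀) ^ Fintype.card F = 0 := by
    rw [hk, pow_add, hsq, zero_mul]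
  calc AdjoinRoot.root (fibPoly W α) ^ Fintype.card F
      = ((AdjoinRoot.root (fibPoly W α) - algebraMap F _ y₀) + algebraMap F _ y₀) ^
          Fintype.card F := by
        rw [sub_add_cancel]
    _ = algebraMap F _ y₀ := by rw [add_pow_card, hzero, algebraMap_pow_card, zero_add]

/-- Exactly one rational point over `α`: `ν₋(α) = (y₀ + Ȳ + a₁α + a₃)² = (Ȳ - y₀)² = 0`. [folklore]
-/
theorem eval_eq_zero_of_one_minus {y₀ : F} (h₀ : W.toAffine.Equation α y₀)
    (huniq : ∀ y, W.toAffine.Equation α y → y = y₀) {p : F[X]}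
    (hp : nu W (uMinus W) = algebraMap F[X] W.toAffine.CoordinateRing p) : p.eval α = 0 := by
  have key := algebraMap_eval_eq_sq W α hp
  rw [evA_uMinus, root_pow_card_of_one W α h₀ huniq] at key
  obtain ⟨hc, -⟩ := coeffs_of_one W α h₀ huniq
  have hsq := root_sub_sq_of_one W α h₀ huniq
  have h : (algebraMap F _ y₀ + AdjoinRoot.root (fibPoly W α) +
      algebraMap F (AdjoinRoot (fibPoly W α)) (W.a₁ * α + W.a₃)) ^ 2 = 0 := by
    rw [hc]
    simp only [map_neg, map_mul, map_ofNat]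
    linear_combination hsq
  rw [h, ← map_zero (algebraMap F (AdjoinRoot (fibPoly W α)))] at key
  exact algebraMap_fibAlg_injective W α key

/-- Exactly one rational point over `α`: `ν₊(α) = (y₀ - Ȳ)² = 0`. [folklore] -/
theorem eval_eq_zero_of_one_plus {y₀ : F} (h₀ : W.toAffine.Equation α y₀)
    (huniq : ∀ y, W.toAffine.Equation α y → y = y₀) {p : F[X]}
    (hp : nu W (uPlus W) = algebraMap F[X] W.toAffine.CoordinateRing p) : p.eval α = 0 := by
  have key := algebraMap_eval_eq_sq W α hp
  rw [evA_uPlus, root_pow_card_of_one W α h₀ huniq] at key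
  have hsq := root_sub_sq_of_one W α h₀ huniq
  have h : (algebraMap F _ y₀ - AdjoinRoot.root (fibPoly W α)) ^ 2 = 0 := by
    linear_combination hsq
  rw [h, ← map_zero (algebraMap F (AdjoinRoot (fibPoly W α)))] at key
  exact algebraMap_fibAlg_injective W α key

end Fibre

/-! ### Root multiplicities of the reduced denominators of `x(P₀ ± Q)` -/

section Multiplicity

omit W in
/-- `(X^q - X)² ≠ 0`. [folklore] -/
theorem X_pow_card_sub_X_sq_ne_zero : ((X ^ Fintype.card F - X : F[X]) ^ 2) ≠ 0 :=
  pow_ne_zero 2 (FiniteField.X_pow_card_sub_X_ne_zero F Fintype.one_lt_card)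

omit W in
/-- If `p v = u (X^q - X)²` and `p(α) ≠ 0`, then `(X - α)² ∣ v`: nothing cancels at `α`. [folklore]
-/
theorem two_le_rootMultiplicity {p u v : F[X]} (α : F) (hv : v ≠ 0)
    (h : p * v = u * (X ^ Fintype.card F - X) ^ 2) (hp : p.eval α ≠ 0) :
    2 ≤ rootMultiplicity α v := by
  rw [le_rootMultiplicity_iff hv]
  have h1 : (X - C α) ^ 2 ∣ p * v := by
    rw [h]
    apply dvd_mul_of_dvd_right
    rw [← le_rootMultiplicity_iff X_pow_card_sub_X_sq_ne_zero, rootMultiplicity_X_pow_card_sub_X_sq]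
  refine (prime_X_sub_C α).pow_dvd_of_dvd_mul_left 2 ?_ h1
  rwa [dvd_iff_isRoot]

omit W in
/-- If `p v = u (X^q - X)²` with `u, v` coprime and `p(α) = 0`, then `(X - α)² ∤ v`: at least one
factor `X - α` cancels. [folklore] -/
theorem rootMultiplicity_le_one {p u v : F[X]} (α : F) (hcop : IsCoprime u v) (hv : v ≠ 0)
    (h : p * v = u * (X ^ Fintype.card F - X) ^ 2) (hp : p.eval α = 0) :
    rootMultiplicity α v ≤ 1 := by
  by_contra hlt
  have h2 : (X - C α) ^ 2 ∣ v := (le_rootMultiplicity_iff hv).mp (by omega)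
  have hpd : (X - C α) ∣ p := dvd_iff_isRoot.mpr hp
  have hu : ¬(X - C α) ∣ u := fun hd =>
    (prime_X_sub_C α).not_unit (hcop.isUnit_of_dvd' hd ((dvd_pow_self _ two_ne_zero).trans h2))
  have h3 : (X - C α) ^ 3 ∣ u * (X ^ Fintype.card F - X) ^ 2 := by
    rw [← h, pow_succ']
    exact mul_dvd_mul hpd h2
  have h4 := (prime_X_sub_C α).pow_dvd_of_dvd_mul_left 3 hu h3
  rw [← le_rootMultiplicity_iff X_pow_card_sub_X_sq_ne_zero, rootMultiplicity_X_pow_card_sub_X_sq]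
    at h4
  omega

/-- A fibre of `x : W(F) → F` has at most two points. [folklore] -/
theorem card_fibre_le_two (α : F) : Nat.card {y : F // W.toAffine.Equation α y} ≤ 2 := by
  classical
  rw [Nat.card_eq_fintype_card, Fintype.card_subtype]
  calc (Finset.univ.filter fun y => W.toAffine.Equation α y).card
      ≤ (fibPoly W α).roots.toFinset.card := by
        apply Finset.card_le_card
        intro y hy
        rw [Finset.mem_filter] at hy
        rw [Multiset.mem_toFinset, mem_roots (fibPoly_ne_zero W α), IsRoot.def,
          eval_fibPoly_eq_zero_iff]
        exact hy.2
    _ ≤ Multiset.card (fibPoly W α).roots := Multiset.toFinset_card_le _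
    _ ≤ (fibPoly W α).natDegree := card_roots' _
    _ = 2 := natDegree_fibPoly W α

/-- **The multiplicity of `α ∈ F` as a root of the reduced denominator of `x(P₀ - Q)` is the number
of rational points of `W` with `x`-coordinate `α`** (`0`, `1` or `2`). The multiplicities of `α` in
`v₊` and `v₋` add up to `2` (`v₊ v₋ ~ (X^q - X)²`), and the three cases are told apart by the values
`ν±(α) = (ev_α u±)²` in the fibre algebra `F[Y]/(W(α, Y))` — this replaces Euler's criterion in
Manin's count (Chahal 2021, proof of Thm. 10.13: there `m` factors of the first and `n` of the
second kind), so that characteristic `2` is covered.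
[cite: Chahal2021, §10.3 proof of Thm. 10.13] -/
theorem rootMultiplicity_eq_card_fibre [W.IsElliptic] {u₁ v₁ u₂ v₂ : F[X]}
    (hadd : IsRep W (xc W (frobPt W + genPt W)) u₁ v₁)
    (hsub : IsRep W (xc W (frobPt W - genPt W)) u₂ v₂) (α : F) :
    rootMultiplicity α v₂ = Nat.card {y : F // W.toAffine.Equation α y} := by
  classical
  obtain ⟨-, -, -, c, hc, hvD⟩ := step_zero W hadd hsub
  obtain ⟨p₁, hp₁, hp₁v⟩ := exists_eq_algebraMap_of_isRep W (xc_frobPt_add_genPt_mul W) hadd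
  obtain ⟨p₂, hp₂, hp₂v⟩ := exists_eq_algebraMap_of_isRep W (xc_frobPt_sub_genPt_mul W) hsub
  -- the two multiplicities sum to `2`
  have hsum : rootMultiplicity α v₁ + rootMultiplicity α v₂ = 2 := by
    have hne : v₁ * v₂ * c ≠ 0 := by rw [hvD]; exact X_pow_card_sub_X_sq_ne_zero
    have h := congrArg (rootMultiplicity α) hvD
    rw [rootMultiplicity_X_pow_card_sub_X_sq, rootMultiplicity_mul hne,
      rootMultiplicity_mul (mul_ne_zero hadd.ne_zero hsub.ne_zero)] at h
    obtain ⟨c₀, -, rfl⟩ := Polynomial.isUnit_iff.mp hc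
    rwa [rootMultiplicity_C, add_zero] at h
  -- case analysis on the number of points in the fibre
  have hle := card_fibre_le_two W α
  rw [Nat.card_eq_fintype_card, Fintype.card_subtype] at hle ⊢
  set S := Finset.univ.filter fun y => W.toAffine.Equation α y with hS
  have hmem : ∀ y, y ∈ S ↔ W.toAffine.Equation α y := fun y => by simp [hS]
  interval_cases hSc : S.card
  · -- no rational point over `α`
    have h0 : ∀ y, ¬W.toAffine.Equation α y := fun y hy => by
      have := (hmem y).mpr hy
      rw [Finset.card_eq_zero.mp hSc] at this
      simp at this
    have := two_le_rootMultiplicity α hadd.ne_zero hp₁v (eval_ne_zero_of_zero W α h0 hp₁)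
    omega
  · -- exactly one rational point over `α`
    obtain ⟨y₀, hy₀⟩ := Finset.card_eq_one.mp hSc
    have h₀ : W.toAffine.Equation α y₀ :=
      (hmem y₀).mp (by rw [hy₀]; exact Finset.mem_singleton_self _)
    have huniq : ∀ y, W.toAffine.Equation α y → y = y₀ := fun y hy => by
      have := (hmem y).mpr hy
      rw [hy₀] at this
      exact Finset.mem_singleton.mp this
    have h1 := rootMultiplicity_le_one α hadd.isCoprime hadd.ne_zero hp₁v
      (eval_eq_zero_of_one_plus W α h₀ huniq hp₁)
    have h2 := rootMultiplicity_le_one α hsub.isCoprime hsub.ne_zero hp₂v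
      (eval_eq_zero_of_one_minus W α h₀ huniq hp₂)
    omega
  · -- two rational points over `α`
    obtain ⟨y₁, y₂, hne, hy⟩ := Finset.card_eq_two.mp hSc
    have h₁ : W.toAffine.Equation α y₁ := (hmem y₁).mp (by rw [hy]; simp)
    have h₂ : W.toAffine.Equation α y₂ := (hmem y₂).mp (by rw [hy]; simp)
    have := two_le_rootMultiplicity α hsub.ne_zero hp₂v
      (eval_ne_zero_of_two W α hne h₁ h₂ hp₂)
    omega

/-- **`d₋₁ = N_q`, denominator form.** The reduced denominator of `x(P₀ - Q)` has degree equal to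
the number of affine `F`-rational points of `W`; with `deg u₋ = deg v₋ + 1` (`step_zero`) and the
point at infinity this is `d₋₁ = #W(F)`. [cite: Chahal2021, §10.3 Thm. 10.13 (10.26)] -/
theorem natDegree_eq_card_affine [W.IsElliptic] {u₁ v₁ u₂ v₂ : F[X]}
    (hadd : IsRep W (xc W (frobPt W + genPt W)) u₁ v₁)
    (hsub : IsRep W (xc W (frobPt W - genPt W)) u₂ v₂) :
    v₂.natDegree = Nat.card {xy : F × F // W.toAffine.Equation xy.1 xy.2} := by
  classical
  obtain ⟨-, -, -, c, hc, hvD⟩ := step_zero W hadd hsub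
  have hsplit : Splits v₂ :=
    Splits.of_dvd ((splits_X_pow_card_sub_X (F := F)).pow 2) X_pow_card_sub_X_sq_ne_zero
      ⟨v₁ * c, by rw [← hvD]; ring⟩
  rw [hsplit.natDegree_eq_card_roots, ← Multiset.toFinset_sum_count_eq,
    Finset.sum_subset (Finset.subset_univ _) (fun a _ ha => by
      rw [Multiset.count_eq_zero]
      exact fun h => ha (Multiset.mem_toFinset.mpr h))]
  simp_rw [count_roots, rootMultiplicity_eq_card_fibre W hadd hsub]
  rw [Nat.card_congr (Equiv.subtypeProdEquivSigmaSubtype fun x y => W.toAffine.Equation x y),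
    Nat.card_sigma]

end Multiplicity

end PartIV

section PartV

/-! ## Part V: the induction and the bound

With `d(n) = n² + a n + q`, `a = q + 1 - #W(F)` (`dg`, `tr`, file I) we prove the invariant
`St n` — `P_n = O ∧ d(n) = 0`, or `P_n ≠ O` and the reduced numerator of `x(P_n)` has degree
`d(n)`, larger than that of the denominator — for every `n ∈ ℤ` (`st_all`; Chahal 2021,
Thm. 10.14): the base cases are `n = 0` (`d₀ = q`) and `n = ±1` (`d₋₁ = #W(F)` from Part IV and
`d₁ = 2q + 2 - d₋₁` from `step_zero`), and the step `st_step` goes in both directions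
(generic case: the basic identity `step` of Part III; degenerate cases `P_n ∈ {O, ±Q}` directly,
using `d(O) = 0`, `d(±Q) = 1`, `d(±2Q) = 4`). Consequently `d(n) ≥ 0` for all `n`, and
`d(n) = 0 ⇒ P_n = O ⇒ P_{n+1} = Q ⇒ d(n + 1) = 1`; an integer argument (`sq_le_four_mul`,
replacing the considerations at the end of Manin's proof, which use that `q` is odd) then gives
`a² ≤ 4q`, i.e. **Hasse's theorem** `|#W(F) - (q + 1)| ≤ 2√q` (`abs_card_sub_le`; Silverman,
*AEC* Thm. V.1.1) for every elliptic curve over every finite field. The named facts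
`Literature.NumberTheory.LFunctions.hasse_bound` and `Literature.NumberTheory.EllipticCurves.hasse_bound` are discharged from it in
`Literature.NumberTheory.LFunctions.RHWave0HasseProofs` and
`Literature.NumberTheory.EllipticCurves.BSDWave0HasseProofs`. -/

variable {F : Type u} [Field F] [Fintype F] (W : WeierstrassCurve F) [W.IsElliptic]

/-! ### Counting points -/

/-- `#W(F) = #{affine F-points} + 1` (the point at infinity). [folklore] -/
theorem card_point : Nat.card W.toAffine.Point =
    Nat.card {xy : F × F // W.toAffine.Equation xy.1 xy.2} + 1 := by
  rw [Nat.card_congr (pointEquiv W.toAffine)]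
  change Nat.card (Option _) = _
  rw [Finite.card_option]

/-! ### Values at the special points -/

omit [Fintype F] in
/-- `x(-Q) = X / 1` in lowest terms. [folklore] -/
theorem isRep_xc_neg_genPt : IsRep W (xc W (-genPt W)) X 1 := by
  rw [xc_neg]; exact isRep_xc_genPt W

omit [Fintype F] in
/-- `d(Q) = 1`: any reduced numerator of `x(Q) = t` has degree `1`. [folklore] -/
theorem natDegree_eq_one_of_isRep_genPt {a b : F[X]} (h : IsRep W (xc W (genPt W)) a b) :
    a.natDegree = 1 := by
  rw [← (isRep_xc_genPt W).natDegree_eq h |>.1, natDegree_X]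

omit [Fintype F] in
/-- `d(2Q) = 4`: any reduced numerator of `x(2Q)` has degree `4`. [folklore] -/
theorem natDegree_eq_four_of_isRep_two_genPt {a b : F[X]}
    (h : IsRep W (xc W (genPt W + genPt W)) a b) : a.natDegree = 4 := by
  rw [← (isRep_xc_two_genPt W).natDegree_eq h |>.1, WeierstrassCurve.natDegree_Φ]; norm_num

omit [Fintype F] in
/-- `-Q ≠ O`. [folklore] -/
theorem neg_genPt_ne_zero : -genPt W ≠ 0 := by
  rw [Ne, neg_eq_zero]; exact genPt_ne_zero W

/-! ### One step of the induction, in both directions -/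

/-- **The induction step, in both directions.** If `St n` holds, then `St (n - 1) → St (n + 1)` and
`St (n + 1) → St (n - 1)`. In the generic case `P_n ∉ {O, ±Q}` this is the basic identity `step`
(`d_{n-1} + d_{n+1} = 2 d_n + 2`); if `P_n = O` the neighbours are `±Q` with `d = 1`; if `P_n = ±Q`
the neighbours are `O` (`d = 0`) and `±2Q` (`d = 4`).
[cite: Chahal2021, §10.3 Thm. 10.14 (proof, induction in both directions)] -/
theorem st_step {n : ℤ} (hn : St W n) :
    (St W (n - 1) → St W (n + 1)) ∧ (St W (n + 1) → St W (n - 1)) := by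
  have hrec := dg_rec W n
  have hΦ : (W.Φ 2).natDegree = 4 := by rw [WeierstrassCurve.natDegree_Φ]; norm_num
  have hP1 := maninPt_add_one W n
  have hM1 := maninPt_sub_one W n
  rcases hP : maninPt W n with _ | ⟨x₁, y₁, h₁⟩
  · -- `P_n = O`: the neighbours are `±Q`
    rw [← Point.zero_def] at hP
    have h0 := hn.dg_eq_zero hP
    rw [hP, zero_add] at hP1
    rw [hP, zero_sub] at hM1
    constructor
    · intro hm
      have := hm.dg_eq_natDegree (by rw [hM1]; exact neg_genPt_ne_zero W)
        (by rw [hM1]; exact isRep_xc_neg_genPt W)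
      refine st_of_rep (by rw [hP1]; exact genPt_ne_zero W) (by rw [hP1]; exact isRep_xc_genPt W)
        (by rw [natDegree_one, natDegree_X]; exact one_pos) ?_
      rw [natDegree_X] at this ⊢; push_cast at this ⊢; linarith
    · intro hp
      have := hp.dg_eq_natDegree (by rw [hP1]; exact genPt_ne_zero W)
        (by rw [hP1]; exact isRep_xc_genPt W)
      refine st_of_rep (by rw [hM1]; exact neg_genPt_ne_zero W)
        (by rw [hM1]; exact isRep_xc_neg_genPt W)
        (by rw [natDegree_one, natDegree_X]; exact one_pos) ?_
      rw [natDegree_X] at this ⊢; push_cast at this ⊢; linarith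
  · by_cases hx : x₁ = gT W
    · -- `P_n = ±Q`
      rcases (Point.X_eq_iff (h₁ := h₁) (h₂ := nonsingular_gT_gS W)).mp hx with hQ | hQ <;>
        rw [← genPt_eq] at hQ <;> rw [hQ] at hP <;> rw [hP] at hP1 hM1
      · -- `P_n = Q`: neighbours `2Q` and `O`
        rw [sub_self] at hM1
        have hdn : dg W n = 1 := by
          rw [hn.dg_eq_natDegree (by rw [hP]; exact genPt_ne_zero W)
            (by rw [hP]; exact isRep_xc_genPt W), natDegree_X]; rfl
        constructor
        · intro hm
          have h0 := hm.dg_eq_zero hM1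
          refine st_of_rep (by rw [hP1]; exact genPt_add_genPt_ne_zero W)
            (by rw [hP1]; exact isRep_xc_two_genPt W)
            (lt_of_le_of_lt W.natDegree_Ψ₂Sq_le (by rw [hΦ]; norm_num)) ?_
          rw [hΦ]; push_cast; linarith
        · intro hp
          have h4 := hp.dg_eq_natDegree (by rw [hP1]; exact genPt_add_genPt_ne_zero W)
            (by rw [hP1]; exact isRep_xc_two_genPt W)
          rw [hΦ] at h4
          left
          exact ⟨hM1, by push_cast at h4; linarith⟩
      · -- `P_n = -Q`: neighbours `O` and `-2Q`
        rw [neg_add_cancel] at hP1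
        rw [← neg_add'] at hM1
        have hdn : dg W n = 1 := by
          rw [hn.dg_eq_natDegree (by rw [hP]; exact neg_genPt_ne_zero W)
            (by rw [hP]; exact isRep_xc_neg_genPt W), natDegree_X]; rfl
        have hne : maninPt W (n - 1) ≠ 0 := by
          rw [hM1, Ne, neg_eq_zero]; exact genPt_add_genPt_ne_zero W
        have hrep2 : IsRep W (xc W (maninPt W (n - 1))) (W.Φ 2) W.Ψ₂Sq := by
          rw [hM1, xc_neg]; exact isRep_xc_two_genPt W
        constructor
        · intro hm
          have h4 := hm.dg_eq_natDegree hne hrep2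
          rw [hΦ] at h4
          left
          exact ⟨hP1, by push_cast at h4; linarith⟩
        · intro hp
          have h0 := hp.dg_eq_zero hP1
          refine st_of_rep hne hrep2
            (lt_of_le_of_lt W.natDegree_Ψ₂Sq_le (by rw [hΦ]; norm_num)) ?_
          rw [hΦ]; push_cast; linarith
    · -- generic case: the basic identity
      obtain ⟨u₁, v₁, hadd0⟩ := exists_isRep_xc_maninPt W (n + 1)
      obtain ⟨u₂, v₂, hsub0⟩ := exists_isRep_xc_maninPt W (n - 1)
      have hadd := hadd0
      have hsub := hsub0
      rw [hP1, hP] at hadd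
      rw [hM1, hP] at hsub
      rcases hn with ⟨h, -⟩ | ⟨-, a, b, hrep, hlt, hd⟩
      · rw [hP] at h; exact absurd h (Point.some_ne_zero _)
      rw [hP, xc_some] at hrep
      obtain ⟨hu, -, hv₁, hv₂, -⟩ := step W h₁ hrep hlt hx hadd hsub
      have hne1 : maninPt W (n + 1) ≠ 0 := by
        rw [hP1, hP, genPt_eq, Point.add_of_X_ne hx]; exact Point.some_ne_zero _
      have hne2 : maninPt W (n - 1) ≠ 0 := by
        rw [hM1, hP, genPt_eq, sub_eq_add_neg, Point.neg_some, Point.add_of_X_ne hx]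
        exact Point.some_ne_zero _
      have hu' : (u₁.natDegree : ℤ) + u₂.natDegree = 2 * a.natDegree + 2 := by exact_mod_cast hu
      constructor
      · intro hm
        have h2 := hm.dg_eq_natDegree hne2 hsub0
        exact st_of_rep hne1 hadd0 hv₁ (by linarith)
      · intro hp
        have h2 := hp.dg_eq_natDegree hne1 hadd0
        exact st_of_rep hne2 hsub0 hv₂ (by linarith)

/-! ### The base cases `n = 0, ±1` -/

/-- `St 0`: `x(P₀) = X^q / 1`, so `d(0) = q`. [cite: ChahalSoomroTop2014, §1 Lemma 1.1 (1)] -/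
theorem st_zero : St W 0 := by
  refine st_of_rep (by rw [maninPt_zero]; exact frobPt_ne_zero W)
    (by rw [maninPt_zero]; exact isRep_xc_frobPt W) ?_ ?_
  · rw [natDegree_one, natDegree_X_pow]; exact Fintype.card_pos
  · rw [natDegree_X_pow, dg_zero]

/-- `P₀ + Q ≠ O` (compare `x`-coordinates: `t^q ≠ t`). [folklore] -/
theorem maninPt_one_ne_zero : maninPt W 1 ≠ 0 := by
  rw [maninPt_one]
  intro h
  have := congrArg (xc W) (eq_neg_of_add_eq_zero_left h)
  rw [xc_neg, xc_frobPt, xc_genPt] at this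
  exact gT_pow_card_ne_gT W this

/-- `P₀ - Q ≠ O` (as `P₀ ≠ Q`). [cite: Chahal2021, §10.3 proof of Thm. 10.13] -/
theorem maninPt_neg_one_ne_zero : maninPt W (-1) ≠ 0 := by
  rw [maninPt_neg_one]
  intro h
  have := congrArg (xc W) (sub_eq_zero.mp h)
  rw [xc_frobPt, xc_genPt] at this
  exact gT_pow_card_ne_gT W this

/-- **`d₋₁ = #W(F)` and `d₁ = 2q + 2 - #W(F)`**, i.e. `St 1` and `St (-1)`: from
`natDegree_eq_card_affine` (Part IV) and `step_zero` (Part III).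
[cite: Chahal2021, §10.3 Thm. 10.13 (10.26)] -/
theorem st_one_and_neg_one : St W 1 ∧ St W (-1) := by
  obtain ⟨u₁, v₁, hadd0⟩ := exists_isRep_xc_maninPt W 1
  obtain ⟨u₂, v₂, hsub0⟩ := exists_isRep_xc_maninPt W (-1)
  have hadd := hadd0
  have hsub := hsub0
  rw [maninPt_one] at hadd
  rw [maninPt_neg_one] at hsub
  obtain ⟨hu, hu₁, hu₂, -⟩ := step_zero W hadd hsub
  have hv₂ := natDegree_eq_card_affine W hadd hsub
  have hN := card_point W
  constructor
  · refine st_of_rep (maninPt_one_ne_zero W) hadd0 (by omega) ?_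
    rw [dg_one]; omega
  · refine st_of_rep (maninPt_neg_one_ne_zero W) hsub0 (by omega) ?_
    rw [dg_neg_one]; omega

/-! ### The induction over `ℤ` -/

/-- Upward induction: `St k` and `St (k + 1)` for all `k : ℕ`. [folklore] -/
theorem st_nat (k : ℕ) : St W k ∧ St W (k + 1) := by
  induction k with
  | zero =>
    refine ⟨?_, ?_⟩
    · rw [Nat.cast_zero]; exact st_zero W
    · rw [Nat.cast_zero, zero_add]; exact (st_one_and_neg_one W).1
  | succ k ih =>
    refine ⟨?_, ?_⟩
    · rw [Nat.cast_succ]; exact ih.2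
    · have h := (st_step W ih.2).1 (by rw [add_sub_cancel_right]; exact ih.1)
      rw [Nat.cast_succ]; exact h

/-- Downward induction: `St (-k)` and `St (-k - 1)` for all `k : ℕ`. [folklore] -/
theorem st_neg_nat (k : ℕ) : St W (-(k : ℤ)) ∧ St W (-(k : ℤ) - 1) := by
  induction k with
  | zero =>
    refine ⟨?_, ?_⟩
    · rw [Nat.cast_zero, neg_zero]; exact st_zero W
    · rw [Nat.cast_zero, neg_zero, zero_sub]; exact (st_one_and_neg_one W).2
  | succ k ih =>
    have e : (-((k + 1 : ℕ) : ℤ)) = -(k : ℤ) - 1 := by push_cast; ring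
    refine ⟨by rw [e]; exact ih.2, ?_⟩
    have h := (st_step W ih.2).2 (by rw [sub_add_cancel]; exact ih.1)
    rw [e]; exact h

/-- **`d(n) = n² + a n + q` for every `n ∈ ℤ`**, in the form of the invariant `St n`.
[cite: Chahal2021, §10.3 Thm. 10.14 (10.30)] -/
theorem st_all (n : ℤ) : St W n := by
  obtain ⟨k, rfl | rfl⟩ := Int.eq_nat_or_neg n
  · exact (st_nat W k).1
  · exact (st_neg_nat W k).1

/-! ### Consequences: `d(n) ≥ 0`, and `d(n) = 0 ⇒ d(n + 1) = 1` -/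

/-- `d(n) = n² + a n + q ≥ 0` for every `n ∈ ℤ` (it is `0` or the degree of a polynomial).
[cite: Chahal2021, §10.3, Proof of the Riemann Hypothesis (after Thm. 10.14)] -/
theorem dg_nonneg (n : ℤ) : 0 ≤ dg W n := (st_all W n).dg_nonneg

/-- If `d(n) = 0` then `P_n = O`, hence `P_{n+1} = Q` and `d(n + 1) = 1`. [folklore] -/
theorem dg_succ_eq_one_of_dg_eq_zero {n : ℤ} (h : dg W n = 0) : dg W (n + 1) = 1 := by
  have h0 := (st_all W n).eq_zero_of_dg_eq_zero h
  have h1 : maninPt W (n + 1) = genPt W := by rw [maninPt_add_one, h0, zero_add]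
  rw [(st_all W (n + 1)).dg_eq_natDegree (by rw [h1]; exact genPt_ne_zero W)
    (by rw [h1]; exact isRep_xc_genPt W), natDegree_X]
  rfl


/-! ### The elementary endgame -/

omit [Fintype F] [W.IsElliptic] in
/-- If `n² + a n + c ≥ 0` for all integers `n`, and `n² + a n + c = 0` forces `(n + 1)² + a (n + 1)
+ c = 1`, then `a² ≤ 4c`. (Take `n` with `2n + a ∈ {0, -1}`; then `4(n² + an + c) = r² - (a² - 4c)`
with `r ∈ {0, 1}`, so `a² > 4c` would force `n² + an + c = 0` and then `4 = (2 - r)² - (a² - 4c) <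
4`.) This integer endgame replaces the final step of Manin's proof as presented by Chahal, which
uses that `q` is odd. [folklore] -/
theorem sq_le_four_mul {a c : ℤ} (hnonneg : ∀ n : ℤ, 0 ≤ n ^ 2 + a * n + c)
    (hsucc : ∀ n : ℤ, n ^ 2 + a * n + c = 0 → (n + 1) ^ 2 + a * (n + 1) + c = 1) :
    a ^ 2 ≤ 4 * c := by
  by_contra hD
  rw [not_le] at hD
  -- choose `n` with `2n + a = -r`, `r ∈ {0, 1}`
  obtain ⟨n, r, hnr, hr01⟩ : ∃ n r : ℤ, 2 * n + a = -r ∧ (r = 0 ∨ r = 1) :=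
    ⟨(-a) / 2, (-a) % 2, by omega, Int.emod_two_eq_zero_or_one _⟩
  have ha : a = -r - 2 * n := by linarith
  have key : 4 * (n ^ 2 + a * n + c) = r ^ 2 - (a ^ 2 - 4 * c) := by rw [ha]; ring
  have h0 := hnonneg n
  have hr2 : r ^ 2 ≤ 1 := by rcases hr01 with h | h <;> rw [h] <;> norm_num
  have hzero : n ^ 2 + a * n + c = 0 := by
    have : 4 * (n ^ 2 + a * n + c) < 4 := by linarith
    omega
  have h1 := hsucc n hzero
  have key1 : 4 * ((n + 1) ^ 2 + a * (n + 1) + c) = (2 - r) ^ 2 - (a ^ 2 - 4 * c) := by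
    rw [ha]; ring
  rw [h1] at key1
  rw [hzero, mul_zero] at key
  rcases hr01 with rfl | rfl <;> norm_num at key key1 <;> linarith

/-- **Hasse's theorem** (the Riemann hypothesis for elliptic curves over finite fields): for an
elliptic curve `W` over a finite field `F` with `q` elements, `|#W(F) - (q + 1)| ≤ 2√q`, where
`#W(F) = Nat.card W.toAffine.Point` counts the affine points together with the point at infinity.
Proved here for every characteristic by the function-field form of Manin's elementary argument
(parts I–V). [cite: SilvermanAEC2009, Thm. V.1.1] -/
theorem abs_card_sub_le :
    |(Nat.card W.toAffine.Point : ℝ) - (Fintype.card F + 1)| ≤ 2 * Real.sqrt (Fintype.card F) := by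
  have hsq : (tr W) ^ 2 ≤ 4 * (Fintype.card F : ℤ) :=
    sq_le_four_mul (fun n => dg_nonneg W n) (fun n hn => dg_succ_eq_one_of_dg_eq_zero W hn)
  have hsqR : ((tr W : ℝ)) ^ 2 ≤ 4 * (Fintype.card F : ℝ) := by exact_mod_cast hsq
  have htr : (tr W : ℝ) = (Fintype.card F : ℝ) + 1 - (Nat.card W.toAffine.Point : ℝ) := by
    simp [tr]
  rw [abs_sub_comm, ← htr, ← Real.sqrt_sq_eq_abs]
  calc Real.sqrt ((tr W : ℝ) ^ 2) ≤ Real.sqrt (4 * (Fintype.card F : ℝ)) := Real.sqrt_le_sqrt hsqR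
    _ = 2 * Real.sqrt (Fintype.card F) := by
      rw [Real.sqrt_mul (by norm_num), show (4 : ℝ) = 2 ^ 2 by norm_num,
        Real.sqrt_sq (by norm_num)]

end PartV

end Literature.NumberTheory.EllipticCurves.HasseManin
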